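import Summits.KontsevichZagierPeriods.KontsevichZagierPeriods.Theorems.HurwitzMicroSectorsNormalFormPrincipleLevelOneReduction

/-!
# `NormalFormPrinciple` (stmt-KontsevichZagierPeriods-3869), line `SketchIdeator1` — the leaf
# `stub_boxRigidity` in dimension two, level two: the dimension-one residue `[(0,1), p(s)/(1 + s)]`

Registered sub-goal `dimOne_levelTwo_reduce` of the layer "Conjecture 1 for
`[(0,1)², P(x,y)/(1 − x²y²)]`" (lead file `…LevelTwo`, wave 3). After the merge gadget at level two an
off-diagonal monomial leaves the one-dimensional representation `N₁ = [(0,1), p(s)/(1 + s)]`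
(`p ∈ ℚ[s]`). It is congruent modulo Kontsevich–Zagier relations to `γ·[(1,2), 1/y] + [pt, a]` with
`γ, a ∈ ℚ` (values `γ log 2 + a`). Chain of moves:

1. (algebra) `p = (s + 1)·p₁ + r` with `p₁ ∈ ℚ[s]`, `r = p(−1) ∈ ℚ` (`exists_eq_X_add_one_mul_add_C`),
   so on `(0,1)` the integrand is `p₁(s) + r/(1 + s)`;
2. (rule 1b) split `N₁` along this sum into the polynomial box `[(0,1), p₁]`
   (`LevelOne.exists_boxPolyRep`) and `[(0,1), r/(1 + s)]` (`Dlog.exists_rep_unit`);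
3. the polynomial box collapses to a rational point `[pt, q]` (`LevelOne.boxPoly_exists_pt`);
4. (rule 2) ONE affine move `y = s + 1` (`Dlog.affine_sub_mem_relations`, Jacobian `1`) carries
   `[(0,1), r/(1 + s)]` onto the dlog representation `[(1,2), r/y]`.

Output `γ := r`, `a := q`; the given `L`, `Z` are reached by congruence. References: M. Kontsevich,
D. Zagier, *Periods* (2001), §1.1 (`log 2 = ∫₁² dy/y`), §1.2 rules (1), (2). No definitions are
introduced.
-/

noncomputable section

open MeasureTheory Set
open scoped Polynomial
open Literature.NumberTheory.Transcendental Literature.NumberTheory.Transcendental.KZ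
open Literature.ModelTheory.ExponentialFields (IsSemialgebraic)

namespace Summit.KontsevichZagierPeriods.HurwitzMicroSectors.NormalFormPrinciple.PiBox.LevelN

/-- **Division by `s + 1` in `ℚ[s]`** (one variable, spelled `MvPolynomial (Fin 1) ℚ`): every `p`
is `(X₀ + 1)·p₁ + C r` for a polynomial `p₁` and a constant `r` (`= p(−1)`). Induction on `p`.
[folklore] -/
theorem exists_eq_X_add_one_mul_add_C (p : MvPolynomial (Fin 1) ℚ) :
    ∃ (p₁ : MvPolynomial (Fin 1) ℚ) (r : ℚ),
      p = (MvPolynomial.X 0 + 1) * p₁ + MvPolynomial.C r := by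
  induction p using MvPolynomial.induction_on with
  | C a => exact ⟨0, a, by ring⟩
  | add p q hp hq =>
    obtain ⟨p₁, r, rfl⟩ := hp
    obtain ⟨q₁, r', rfl⟩ := hq
    exact ⟨p₁ + q₁, r + r', by simp only [map_add]; ring⟩
  | mul_X p n hp =>
    obtain ⟨p₁, r, rfl⟩ := hp
    obtain rfl : n = 0 := Fin.fin_one_eq_zero n
    exact ⟨p₁ * MvPolynomial.X 0 + MvPolynomial.C r, -r, by simp only [map_neg]; ring⟩

/-- The open unit box of `ℝ¹` is the open unit slab (first-coordinate spelling). [folklore] -/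
theorem box_one_eq_slab :
    ({x | ∀ i, x i ∈ Set.Ioo (0:ℝ) 1} : Set (Fin 1 → ℝ)) = {x | x 0 ∈ Set.Ioo (0:ℝ) 1} := by
  ext x
  simp only [mem_setOf_eq, Fin.forall_fin_one]

/-- **V8 (registered sub-goal `dimOne_levelTwo_reduce` of stmt-KontsevichZagierPeriods-3869).**
The dimension-one residue of the level-two merge gadget, `N₁ = [(0,1), p(s)/(1 + s)]` (`p ∈ ℚ[s]`),
differs by Kontsevich–Zagier relations from `[(1,2), γ/y] + [pt, a]` for rational `γ, a`, for EVERY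
dlog representation `L = [(1,2), γ/y]` and EVERY point representation `Z = [pt, a]`: write
`p = (s+1)p₁ + r`, split (rule 1b), collapse the polynomial box `[(0,1), p₁]` to `[pt, q]`, and move
`[(0,1), r/(1+s)]` onto `[(1,2), r/y]` by `y = s + 1` (rule 2); `γ = r`, `a = q`.
[cite: KontsevichZagier2001, §1.2] -/
theorem dimOne_levelTwo_reduce (p : MvPolynomial (Fin 1) ℚ) (N₁ : IntegralRep 1)
    (hN₁d : N₁.domain = {x | ∀ i, x i ∈ Set.Ioo (0:ℝ) 1})
    (hN₁i : EqOn N₁.integrand (fun x => (MvPolynomial.aeval x p : ℝ) / (1 + x 0)) N₁.domain) :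
    ∃ γ a : ℚ, ∀ (L : IntegralRep 1) (Z : IntegralRep 0),
      L.domain = {x | x 0 ∈ Set.Ioo (1:ℝ) 2} → EqOn L.integrand (fun x => (γ : ℝ) / x 0) L.domain →
      Z.domain = Set.univ → (Z.integrand = fun _ => (a : ℝ)) →
      of N₁ - of L - of Z ∈ relations := by
  -- (1) division by `s + 1`
  obtain ⟨p₁, r, rfl⟩ := exists_eq_X_add_one_mul_add_C p
  -- (2) the two pieces on `(0,1)`: the polynomial box `[(0,1), p₁]` and `[(0,1), r/(1+s)]`
  obtain ⟨Np, hNpd, hNpi⟩ := LevelOne.exists_boxPolyRep p₁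
  have hQ : ∀ t ∈ Set.Icc (0:ℝ) 1, (Polynomial.aeval t (Polynomial.X + 1 : ℚ[X]) : ℝ) ≠ 0 := by
    intro t ht
    simp only [map_add, Polynomial.aeval_X, map_one]
    exact (add_pos_of_nonneg_of_pos ht.1 one_pos).ne'
  obtain ⟨Nr, hNrd, hNri⟩ := Dlog.exists_rep_unit (Polynomial.C r) (Polynomial.X + 1) hQ
  have hNri' : ∀ x, Nr.integrand x = (r : ℝ) / (x 0 + 1) := fun x => by
    rw [hNri]
    simp only [Polynomial.aeval_C, eq_ratCast, map_add, Polynomial.aeval_X, map_one]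
  -- (3) the polynomial box collapses to a rational point
  obtain ⟨q, hq⟩ := LevelOne.boxPoly_exists_pt p₁ Np hNpd hNpi
  refine ⟨r, q, fun L Z hLd hLi hZd hZi => ?_⟩
  -- rule 1b: `N₁ ≡ Np + Nr`
  have hsplit : of N₁ - of Np - of Nr ∈ relations := by
    refine integrandAddRel_subset_relations ⟨1, N₁, Np, Nr, hNpd.trans hN₁d.symm,
      (hNrd.trans box_one_eq_slab.symm).trans hN₁d.symm, fun x hx => ?_, rfl⟩
    have hxp : x ∈ Np.domain := by rw [hNpd, ← hN₁d]; exact hx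
    have hx0 : 0 < x 0 := by
      rw [hN₁d] at hx
      exact (hx 0).1
    have h1 : (1 : ℝ) + x 0 ≠ 0 := (add_pos one_pos hx0).ne'
    rw [Pi.add_apply, hN₁i hx, hNpi hxp, hNri' x]
    simp only [map_add, map_mul, MvPolynomial.aeval_X, map_one, MvPolynomial.aeval_C, eq_ratCast]
    field_simp
    ring
  -- rule 2: the affine move `y = s + 1` carries `[(0,1), r/(1+s)]` onto `[(1,2), r/y]`
  have haff : of Nr - of L ∈ relations := by
    refine Dlog.affine_sub_mem_relations (s := 1) (t := 1) one_ne_zero Nr L (fun y => (r : ℝ) / y)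
      ?_ hLi fun x _ => ?_
    · rw [hNrd, Dlog.image_affine_slab_of_pos (by norm_num : (0:ℝ) < ((1:ℚ):ℝ)), hLd]
      norm_num
    · rw [hNri' x]
      simp only [Rat.cast_one, one_mul, abs_one, mul_one]
  have e : of N₁ - of L - of Z = (of N₁ - of Np - of Nr) + (of Nr - of L) + (of Np - of Z) := by
    abel
  rw [e]
  exact relations.add_mem (relations.add_mem hsplit haff) (hq Z hZd hZi)

end Summit.KontsevichZagierPeriods.HurwitzMicroSectors.NormalFormPrinciple.PiBox.LevelN
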